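/-
Copyright: cell `pub-balaban-gaps` (G2), seat ne6 (row NE7b), `prover-pub-balaban-gaps-ne6-g16-0`. Project licence.
-/
import Summits.QuantumFields.BalabanUV.T4Continuum.Spine.NE7b.CompactFibrePlaquetteMassSU2Explicit
import Mathlib.Analysis.Calculus.Deriv.MeanValue

/-!
# Census V42: THE `SU(2)` WINDOW LAW BY VALUE, UPPER HALF — `Haar_{SU(2)}{Re tr(1 − V) ≤ t} ≤ (2∕(3π))·t^{3∕2}` for all `t ≥ 0`
# (with V41's floor `t^{3∕2}∕8`: the two-sided window law of V29∕V33∕V36 for `N = 2` WITH THE CONSTANTS PRINTED; row NE7b, node U5c; MODEL, [folklore])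

Cell `pub-balaban-gaps` (G2 spine census) for the `pub-balaban` T⁴ crux NE7b (NOT PRINTED, NOT PROVED).  V40a gave the window law of the `SU(2)` fibre in
closed form, `Haar{Re tr(1 − V) ≤ 2 − 2cos ψ} = (ψ − sin ψ cos ψ)∕π`; V40b showed the cap profile `(ψ − sin ψ cos ψ)∕sin³(ψ∕2)` is non-increasing on `(0, π]`.
Its supremum is the limit `16∕3` at `ψ → 0⁺`; this file proves the resulting GLOBAL bound `ψ − sin ψ cos ψ ≤ (16∕3)·sin³(ψ∕2)` on `[0, π]` directly
(the gap has derivative `8 sin²(ψ∕2) cos(ψ∕2)(1 − cos(ψ∕2)) ≥ 0`) and reads it as `Haar_{SU(2)}{Re tr(1 − V) ≤ t} ≤ (2∕(3π))·(√t)³` for every `t ≥ 0`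
(`t = 4 sin²(ψ∕2)`; trivially true above `t = 4`).  With V41's `sqrt_cube_div_eight_le_haarReal_traceWindow` the `N = 2` window law is bracketed BY VALUE:
`(√t)³∕8 ≤ Haar{Re tr(1 − V) ≤ t} ≤ (2∕(3π))·(√t)³` on `(0, 4]` (`0.125` vs `0.2122…`): the ceiling constant `2∕(3π)` is the small-`t` LIMIT of the law (sharp),
the floor is attained at `t = 4`.  V29 (`CompactFibreWindowSUNRate`) had both sides for every `N` with SOFT constants.
No `def`, zero `sorry`, nothing of Bałaban's asserted.  BY-NAME EFFECT ON THE WALL: NONE.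
HONEST DEPENDENCY: continuum YM on T⁴ ⇐ BetaPertH ∧ nine spine estimates (0/9 proved); BetaPertH ⇐ (D1) ∧ (D4) ∧ CAP+tail;
G-an2-4 gates asym, D1 and NE2/3/4.  This file changes none of it.
-/

set_option autoImplicit false

noncomputable section

open MeasureTheory Real Set
open Literature.MathematicalPhysics.QuantumFieldTheory (haarProbability)
open Summit.QuantumFields.BalabanUV.T4Continuum.NE7b.CompactFibreWindowSU2Exact (haar_traceCap_angle_eq)
open Summit.QuantumFields.BalabanUV.T4Continuum.NE7b.CompactFibreWindowSU2Doubling (hasDerivAt_capFun hasDerivAt_sinHalf_cube two_sub_two_cos two_sub_two_cos_arccos capFun_nonneg)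
open Summit.QuantumFields.BalabanUV.T4Continuum.NE7b.CompactFibreWindowSU2DoublingHaar (re_trace_one_sub_eq)
open Summit.QuantumFields.BalabanUV.T4Continuum.NE7b.CompactFibrePlaquetteMassSU2Explicit (sqrt_cube_div_eight_le_haarReal_traceWindow)

namespace Summit.QuantumFields.BalabanUV.T4Continuum.NE7b.CompactFibreWindowSU2Explicit

/-- The gap `g(x) = (16∕3)·sin³(x∕2) − (x − sin x cos x)` has derivative `8·sin²(x∕2)·cos(x∕2)·(1 − cos(x∕2))`. [folklore] -/
theorem hasDerivAt_capGap (ψ : ℝ) :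
    HasDerivAt (fun x : ℝ => 16 / 3 * Real.sin (x / 2) ^ 3 - (x - Real.sin x * Real.cos x))
      (8 * Real.sin (ψ / 2) ^ 2 * Real.cos (ψ / 2) * (1 - Real.cos (ψ / 2))) ψ := by
  have h1 := (hasDerivAt_sinHalf_cube ψ).const_mul (16 / 3)
  have h2 := hasDerivAt_capFun ψ
  refine (h1.sub h2).congr_deriv ?_
  have hsin : Real.sin ψ = 2 * Real.sin (ψ / 2) * Real.cos (ψ / 2) := by
    rw [← Real.sin_two_mul, show 2 * (ψ / 2) = ψ by ring]
  rw [hsin]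
  ring

/-- **THE CAP PROFILE IS AT MOST ITS LIMIT AT THE POLE**: `ψ − sin ψ cos ψ ≤ (16∕3)·sin³(ψ∕2)` for `0 ≤ ψ ≤ π` (the gap vanishes at `0` and is non-decreasing on `[0, π]`,
where `cos(ψ∕2) ≥ 0`). With V40b's `antitoneOn_capProfile` this identifies `sup_{(0,π]} (ψ − sin ψ cos ψ)∕sin³(ψ∕2) = 16∕3`. [folklore] -/
theorem capFun_le_sinHalf_cube {ψ : ℝ} (h0 : 0 ≤ ψ) (hπ : ψ ≤ Real.pi) :
    ψ - Real.sin ψ * Real.cos ψ ≤ 16 / 3 * Real.sin (ψ / 2) ^ 3 := by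
  have hmono : MonotoneOn (fun x : ℝ => 16 / 3 * Real.sin (x / 2) ^ 3 - (x - Real.sin x * Real.cos x)) (Set.Icc 0 Real.pi) :=
    monotoneOn_of_deriv_nonneg (convex_Icc 0 Real.pi) (fun x _ => (hasDerivAt_capGap x).continuousAt.continuousWithinAt)
      (fun x _ => (hasDerivAt_capGap x).differentiableAt.differentiableWithinAt) fun x hx => by
        rw [interior_Icc] at hx
        rw [(hasDerivAt_capGap x).deriv]
        have hc : 0 ≤ Real.cos (x / 2) := Real.cos_nonneg_of_mem_Icc ⟨by linarith [hx.1, Real.pi_pos], by linarith [hx.2]⟩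
        have hc1 : Real.cos (x / 2) ≤ 1 := Real.cos_le_one _
        exact mul_nonneg (mul_nonneg (mul_nonneg (by norm_num) (sq_nonneg _)) hc) (sub_nonneg.2 hc1)
  have h := hmono (Set.left_mem_Icc.2 Real.pi_pos.le) ⟨h0, hπ⟩ h0
  simp only [zero_div, Real.sin_zero, Real.cos_zero, sub_zero, mul_one] at h
  norm_num at h
  linarith

/-- **THE `SU(2)` WINDOW LAW FROM ABOVE, BY VALUE**: `Haar_{SU(2)}{Re tr(1 − V) ≤ t} ≤ (2∕(3π))·(√t)³` for every `t ≥ 0` — V40a's cap law at `t = 4 sin²(ψ∕2)` and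
`capFun_le_sinHalf_cube` for `t ≤ 4`; above `t = 4` the window is all of `SU(2)` and `(2∕(3π))·(√t)³ ≥ 16∕(3π) > 1`.  With V41's floor `(√t)³∕8` this is the two-sided
window law of V29 (`CompactFibreWindowSUNRate`) for `N = 2` with both constants printed. [folklore] -/
theorem haarReal_traceWindow_le_explicit {t : ℝ} (ht0 : 0 ≤ t) :
    (haarProbability (Matrix.specialUnitaryGroup (Fin 2) ℂ)).real
        {V : Matrix.specialUnitaryGroup (Fin 2) ℂ | (Matrix.trace (1 - (V : Matrix (Fin 2) (Fin 2) ℂ))).re ≤ t}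
      ≤ 2 / (3 * Real.pi) * Real.sqrt t ^ 3 := by
  have hπ := Real.pi_pos
  have hπ4 : Real.pi ≤ 4 := Real.pi_le_four
  rcases le_or_gt t 4 with ht4 | ht4
  · -- `t ≤ 4`: the angle `ψ = arccos(1 − t∕2) ∈ [0, π]` with `2 − 2cos ψ = t = 4 sin²(ψ∕2)`
    set ψ := Real.arccos (1 - t / 2) with hψ
    have hψ0 : 0 ≤ ψ := Real.arccos_nonneg _
    have hψπ : ψ ≤ Real.pi := Real.arccos_le_pi _
    have htψ : 2 - 2 * Real.cos ψ = t := two_sub_two_cos_arccos ht0 ht4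
    have hts : t = 4 * Real.sin (ψ / 2) ^ 2 := by rw [← htψ, two_sub_two_cos]
    have hs0 : 0 ≤ Real.sin (ψ / 2) := Real.sin_nonneg_of_nonneg_of_le_pi (by linarith) (by linarith)
    have hsq : Real.sqrt t = 2 * Real.sin (ψ / 2) := by
      rw [hts, show 4 * Real.sin (ψ / 2) ^ 2 = (2 * Real.sin (ψ / 2)) ^ 2 by ring, Real.sqrt_sq (by linarith)]
    have hset : {V : Matrix.specialUnitaryGroup (Fin 2) ℂ | (Matrix.trace (1 - (V : Matrix (Fin 2) (Fin 2) ℂ))).re ≤ t}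
        = {V : Matrix.specialUnitaryGroup (Fin 2) ℂ | 2 * Real.cos ψ ≤ (Matrix.trace (V : Matrix (Fin 2) (Fin 2) ℂ)).re} := by
      ext V; simp only [Set.mem_setOf_eq, re_trace_one_sub_eq, ← htψ]; constructor <;> intro h <;> linarith
    have hm : (haarProbability (Matrix.specialUnitaryGroup (Fin 2) ℂ)).real
        {V : Matrix.specialUnitaryGroup (Fin 2) ℂ | (Matrix.trace (1 - (V : Matrix (Fin 2) (Fin 2) ℂ))).re ≤ t} = (ψ - Real.sin ψ * Real.cos ψ) / Real.pi := by
      rw [hset, measureReal_def, haar_traceCap_angle_eq hψ0 hψπ, ENNReal.toReal_ofReal (div_nonneg (capFun_nonneg hψ0) hπ.le)]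
    rw [hm, hsq, div_le_iff₀ hπ]
    have e : 2 / (3 * Real.pi) * (2 * Real.sin (ψ / 2)) ^ 3 * Real.pi = 16 / 3 * Real.sin (ψ / 2) ^ 3 := by
      field_simp; ring
    rw [e]
    exact capFun_le_sinHalf_cube hψ0 hψπ
  · -- `t > 4`: the window is everything
    have hs2 : 2 ≤ Real.sqrt t := by
      rw [show (2 : ℝ) = Real.sqrt (2 ^ 2) by rw [Real.sqrt_sq (by norm_num : (0:ℝ) ≤ 2)]]
      exact Real.sqrt_le_sqrt (by linarith)
    have h8 : (8 : ℝ) ≤ Real.sqrt t ^ 3 := by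
      have h := pow_le_pow_left₀ (by norm_num : (0 : ℝ) ≤ 2) hs2 3
      norm_num at h
      exact h
    have hge1 : 1 ≤ 2 / (3 * Real.pi) * Real.sqrt t ^ 3 := by
      rw [div_mul_eq_mul_div, le_div_iff₀ (by positivity)]; nlinarith
    exact measureReal_le_one.trans hge1

/-- **THE TWO-SIDED `SU(2)` WINDOW LAW BY VALUE** (this file's ceiling with V41's floor — junction J1's `D = 1` doubling read downward — in one display):
for `0 < t ≤ 4`, `(√t)³∕8 ≤ Haar_{SU(2)}{Re tr(1 − V) ≤ t} ≤ (2∕(3π))·(√t)³`. [folklore] -/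
theorem haarReal_traceWindow_mem_Icc {t : ℝ} (ht0 : 0 < t) (ht4 : t ≤ 4) :
    (haarProbability (Matrix.specialUnitaryGroup (Fin 2) ℂ)).real
        {V : Matrix.specialUnitaryGroup (Fin 2) ℂ | (Matrix.trace (1 - (V : Matrix (Fin 2) (Fin 2) ℂ))).re ≤ t}
      ∈ Set.Icc (Real.sqrt t ^ 3 / 8) (2 / (3 * Real.pi) * Real.sqrt t ^ 3) :=
  ⟨sqrt_cube_div_eight_le_haarReal_traceWindow ht0 ht4, haarReal_traceWindow_le_explicit ht0.le⟩

end Summit.QuantumFields.BalabanUV.T4Continuum.NE7b.CompactFibreWindowSU2Explicit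

end
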